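import Mathlib.Analysis.Calculus.Deriv.Pi
import Mathlib.Analysis.Calculus.Deriv.Prod
import Mathlib.Analysis.Calculus.Deriv.Comp
import Mathlib.Analysis.Calculus.MeanValue
import Mathlib.MeasureTheory.Integral.IntervalIntegral.FundThmCalculus
import Literature.MathematicalPhysics.KineticTheory.LangevinChainNESSProofs
import Literature.Barriers.AtomisticToContinuum.AnticontinuumLocalization
import HarnessLib

/-!
# Rotor chain dynamics: chain rule along the flow, energy conservation, locality

Support file for `Literature/Barriers/AtomisticToContinuum/AnticontinuumLocalization.lean`
(De Roeck–Huveneers 2015, the anti-continuum localization barrier), first of the files reducing the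
barrier fact `DeRoeckHuveneers2015_thm2` (Theorem 2) to Theorem 1 plus stationarity and
decorrelation (`…Estimates.lean`, `…Thm2.lean`). Everything here is PROVED (folklore calculus for the
rotor chain of §2.1 on the tree's lifted phase space `PhaseSpace N = ℝ^N × ℝ^N`):

* `RotorChain.partialP_hamiltonian` : `∂_{ω_x} H = ω_x`; `RotorChain.contDiff_hamiltonian`;
  `RotorChain.continuous_bondCurrent`, `RotorChain.continuous_totalCurrent`,
  `RotorChain.continuous_liouville`.
* `RotorChain.fderiv_apply_eq_sum` : `DU(z)·v = ∑_x (∂_{q_x}U v_q,x + ∂_{ω_x}U v_ω,x)` (the tree's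
  coordinate partials `partialQ`, `partialP` of `FouriersLaw.lean`, via
  `partialQ_eq_fderiv`/`partialP_eq_fderiv` of `LangevinChainNESSProofs.lean`).
* `RotorChain.IsFlow.hasDerivAt_comp` : **chain rule along a flow of Hamilton's equations**,
  `d/ds U(X^s z) = (L_H U)(X^s z)` with `L_H = {H, ·}` the Liouville operator `RotorChain.liouville`
  [cite: DeRoeckHuveneers2015, §2.2 eq. (2.4)]; `RotorChain.IsFlow.integral_liouville` (its
  integrated form, FTC-2) and `RotorChain.IsFlow.hamiltonian_apply` (conservation of energy,
  `L_H H = 0`).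
* `RotorChain.DependsOnlyNear.partialQ_eq_zero` / `partialP_eq_zero` : a function depending only on
  the sites within distance `R` of `a` has vanishing partial derivatives at the other sites.

No new definitions; nothing here is specific to small coupling.
-/

noncomputable section

open MeasureTheory Filter Topology Set
open scoped ContDiff ENNReal

namespace Literature.Barriers.AtomisticToContinuum.HeatConduction.RotorChain

open Literature.MathematicalPhysics.KineticTheory.HeatConduction

variable {N : ℕ}

/-- Decomposition of a phase-space vector along the coordinate axes `(e_x, 0)`, `(0, e_x)`.
[folklore] -/
theorem phaseSpace_eq_sum (v : PhaseSpace N) :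
    v = ∑ x : Fin N, (v.1 x • ((Pi.single x 1, 0) : PhaseSpace N) +
      v.2 x • ((0, Pi.single x 1) : PhaseSpace N)) := by
  ext y
  · simp [Prod.fst_sum, Finset.sum_apply, Pi.single_apply]
  · simp [Prod.snd_sum, Finset.sum_apply, Pi.single_apply]

/-- The differential in coordinates: `DU(z)·v = ∑_x (∂_{q_x}U(z) v.1 x + ∂_{ω_x}U(z) v.2 x)` for a
differentiable `U`. [folklore] -/
theorem fderiv_apply_eq_sum {U : PhaseSpace N → ℝ} (hU : Differentiable ℝ U) (z v : PhaseSpace N) :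
    fderiv ℝ U z v = ∑ x : Fin N, (partialQ x U z * v.1 x + partialP x U z * v.2 x) := by
  conv_lhs => rw [phaseSpace_eq_sum v]
  rw [map_sum]
  refine Finset.sum_congr rfl fun x _ => ?_
  rw [map_add, map_smul, map_smul]
  simp only [partialQ_eq_fderiv hU, partialP_eq_fderiv hU, smul_eq_mul]
  ring

/-- `∂_{ω_x} H = ω_x` for the rotor Hamiltonian `H = ½∑ω² + εV(q)`. [folklore] -/
theorem partialP_hamiltonian (ε γ : ℝ) (x : Fin N) (z : PhaseSpace N) :
    partialP x (hamiltonian N ε γ) z = z.2 x := by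
  unfold partialP hamiltonian siteEnergy
  have h : ∀ t : ℝ, HasDerivAt (fun t : ℝ => ∑ y : Fin N,
      ((Function.update z.2 x t) y ^ 2 / 2 + ε * sitePotential N γ z.1 y))
      (∑ y : Fin N, if y = x then t else 0) t := by
    intro t
    refine HasDerivAt.fun_sum fun y _ => ?_
    by_cases hy : y = x
    · subst hy
      rw [if_pos rfl]
      simp only [Function.update_self]
      have h1 : HasDerivAt (fun s : ℝ => s ^ 2 / 2 + ε * sitePotential N γ z.1 y)
          (↑(2 : ℕ) * t ^ (2 - 1) / 2) t :=
        ((hasDerivAt_pow 2 t).div_const 2).add_const _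
      exact h1.congr_deriv (by norm_num)
    · simp only [Function.update_of_ne hy, hy, if_false]
      exact hasDerivAt_const _ _
  rw [(h (z.2 x)).deriv]
  simp [Finset.sum_ite_eq']

/-- The rotor Hamiltonian is smooth. [folklore] -/
theorem contDiff_hamiltonian (ε γ : ℝ) {n : WithTop ℕ∞} : ContDiff ℝ n (hamiltonian N ε γ) := by
  unfold hamiltonian siteEnergy sitePotential
  apply ContDiff.sum
  intro x _
  apply ContDiff.add
  · fun_prop
  · apply ContDiff.mul contDiff_const
    apply ContDiff.add
    · fun_prop
    · apply ContDiff.sum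
      intro y _
      by_cases h : y.val = x.val + 1
      · simp only [h, if_true]
        fun_prop
      · simp only [h, if_false]
        fun_prop

/-- The bond currents `J_{a,a+1}` are continuous. [folklore] -/
theorem continuous_bondCurrent (a : Fin N) : Continuous (bondCurrent N a) := by
  unfold bondCurrent
  refine continuous_finsetSum _ fun y _ => ?_
  by_cases h : y.val = a.val + 1
  · simp only [h, if_true]
    fun_prop
  · simp only [h, if_false]
    fun_prop

/-- The total current `𝒥_N` is continuous. [folklore] -/
theorem continuous_totalCurrent : Continuous (totalCurrent N) := by
  unfold totalCurrent
  exact (continuous_finsetSum _ fun a _ => continuous_bondCurrent a).div_const _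

/-- `L_H U` is continuous for `U ∈ C¹`. [folklore] -/
theorem continuous_liouville (ε γ : ℝ) {U : PhaseSpace N → ℝ} {n : WithTop ℕ∞}
    (hU : ContDiff ℝ n U) (hn : n ≠ 0) : Continuous (liouville N ε γ U) := by
  unfold liouville
  refine continuous_finsetSum _ fun x _ => ?_
  have h1 := continuous_partialQ (contDiff_hamiltonian (N := N) ε γ (n := 1)) one_ne_zero x
  have h2 := continuous_partialP (contDiff_hamiltonian (N := N) ε γ (n := 1)) one_ne_zero x
  have h3 := continuous_partialQ hU hn x
  have h4 := continuous_partialP hU hn x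
  fun_prop

/-- `L_H H = {H, H} = 0`. [folklore] -/
theorem liouville_hamiltonian (ε γ : ℝ) (z : PhaseSpace N) :
    liouville N ε γ (hamiltonian N ε γ) z = 0 := by
  unfold liouville
  exact Finset.sum_eq_zero fun x _ => by ring

/-- The velocity of a flow curve `s ↦ X^s z`: `(ω, -∇_q H)` at `X^t z`.
[cite: DeRoeckHuveneers2015, §2.1 eq. (2.2)] -/
theorem IsFlow.hasDerivAt_curve {ε γ : ℝ} {Φ : ℝ → PhaseSpace N → PhaseSpace N}
    (hΦ : IsFlow N ε γ Φ) (z : PhaseSpace N) (t : ℝ) :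
    HasDerivAt (fun s => Φ s z)
      (((Φ t z).2, fun x => -(partialQ x (hamiltonian N ε γ) (Φ t z))) : PhaseSpace N) t := by
  refine HasDerivAt.prodMk ?_ ?_
  · exact hasDerivAt_pi.2 fun x => (hΦ.2.2 z x t).1
  · exact hasDerivAt_pi.2 fun x => (hΦ.2.2 z x t).2

/-- **Chain rule along the flow**: `d/ds U(X^s z) = (L_H U)(X^s z)` for differentiable `U` and any
flow `X` of Hamilton's equations of the rotor chain (`q̇ = ∇_ω H = ω`, `ω̇ = -∇_q H`, and
`L_H U = ∇_ω H·∇_q U - ∇_q H·∇_ω U`). [cite: DeRoeckHuveneers2015, §2.2 eq. (2.4)] -/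
theorem IsFlow.hasDerivAt_comp {ε γ : ℝ} {Φ : ℝ → PhaseSpace N → PhaseSpace N}
    (hΦ : IsFlow N ε γ Φ) {U : PhaseSpace N → ℝ} (hU : Differentiable ℝ U) (z : PhaseSpace N)
    (t : ℝ) : HasDerivAt (fun s => U (Φ s z)) (liouville N ε γ U (Φ t z)) t := by
  have h := (hU (Φ t z)).hasFDerivAt.comp_hasDerivAt t (hΦ.hasDerivAt_curve z t)
  have h' : HasDerivAt (fun s => U (Φ s z)) (fderiv ℝ U (Φ t z)
      (((Φ t z).2, fun x => -(partialQ x (hamiltonian N ε γ) (Φ t z))) : PhaseSpace N)) t := h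
  convert h' using 1
  rw [fderiv_apply_eq_sum hU, liouville]
  refine Finset.sum_congr rfl fun x _ => ?_
  rw [partialP_hamiltonian]
  ring

/-- **FTC along the flow**: `∫ₐᵇ (L_H U)(X^s z) ds = U(X^b z) - U(X^a z)` for `U ∈ C¹`.
[folklore] -/
theorem IsFlow.integral_liouville {ε γ : ℝ} {Φ : ℝ → PhaseSpace N → PhaseSpace N}
    (hΦ : IsFlow N ε γ Φ) {U : PhaseSpace N → ℝ} {n : WithTop ℕ∞} (hU : ContDiff ℝ n U)
    (hn : n ≠ 0) (z : PhaseSpace N) (a b : ℝ) :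
    ∫ s in a..b, liouville N ε γ U (Φ s z) = U (Φ b z) - U (Φ a z) := by
  have hc : Continuous fun s : ℝ => Φ s z := hΦ.1.comp (continuous_id.prodMk continuous_const)
  refine intervalIntegral.integral_eq_sub_of_hasDerivAt
    (fun s _ => hΦ.hasDerivAt_comp (hU.differentiable hn) z s) ?_
  exact ((continuous_liouville ε γ hU hn).comp hc).intervalIntegrable _ _

/-- **Conservation of energy** along any flow of Hamilton's equations: `H(X^t z) = H(z)`.
[folklore] -/
theorem IsFlow.hamiltonian_apply {ε γ : ℝ} {Φ : ℝ → PhaseSpace N → PhaseSpace N}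
    (hΦ : IsFlow N ε γ Φ) (t : ℝ) (z : PhaseSpace N) :
    hamiltonian N ε γ (Φ t z) = hamiltonian N ε γ z := by
  have h : ∀ s, HasDerivAt (fun s => hamiltonian N ε γ (Φ s z)) 0 s := fun s => by
    simpa [liouville_hamiltonian] using
      hΦ.hasDerivAt_comp ((contDiff_hamiltonian ε γ (n := 1)).differentiable one_ne_zero) z s
  have := is_const_of_deriv_eq_zero (fun s => (h s).differentiableAt) (fun s => (h s).deriv) t 0
  rw [this, hΦ.2.1 z]

/-- Locality of `∂_{q_x}`: a function depending only on the sites within distance `R` of `a` has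
`∂_{q_x} F = 0` at every site `x` with `|x - a| > R`. [folklore] -/
theorem DependsOnlyNear.partialQ_eq_zero {a : Fin N} {R : ℝ} {F : PhaseSpace N → ℝ}
    (hF : DependsOnlyNear N a R F) {x : Fin N} (hx : R < |(x.val : ℝ) - a.val|)
    (z : PhaseSpace N) : partialQ x F z = 0 := by
  unfold partialQ
  have h : (fun t => F (Function.update z.1 x t, z.2)) = fun _ => F z := by
    funext t
    refine hF _ _ fun y hy => ?_
    have hyx : y ≠ x := fun h => by rw [h] at hy; exact absurd hy (not_le.2 hx)
    simp [Function.update_of_ne hyx]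
  rw [h, deriv_const]

/-- Locality of `∂_{ω_x}` (as `DependsOnlyNear.partialQ_eq_zero`). [folklore] -/
theorem DependsOnlyNear.partialP_eq_zero {a : Fin N} {R : ℝ} {F : PhaseSpace N → ℝ}
    (hF : DependsOnlyNear N a R F) {x : Fin N} (hx : R < |(x.val : ℝ) - a.val|)
    (z : PhaseSpace N) : partialP x F z = 0 := by
  unfold partialP
  have h : (fun t => F (z.1, Function.update z.2 x t)) = fun _ => F z := by
    funext t
    refine hF _ _ fun y hy => ?_
    have hyx : y ≠ x := fun h => by rw [h] at hy; exact absurd hy (not_le.2 hx)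
    simp [Function.update_of_ne hyx]
  rw [h, deriv_const]

end Literature.Barriers.AtomisticToContinuum.HeatConduction.RotorChain

end
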